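import Summits.ResolutionOfSingularities.ResolutionOfSingularities.Theorems.WeightedInvariantContactCylinderCompatibility
import Summits.ResolutionOfSingularities.ResolutionOfSingularities.Theorems.WeightedInvariantContactCentreFiltrationRegular
import Summits.ResolutionOfSingularities.ResolutionOfSingularities.Theorems.WeightedInvariantWeightedChartPrimaryLocal
import Summits.ResolutionOfSingularities.ResolutionOfSingularities.Theorems.WeightedInvariantWeightedConstructionWeightedChartBasicOpen
import Summits.ResolutionOfSingularities.ResolutionOfSingularities.Theorems.WeightedInvariantWeightedConstructionCobordantBlowupRegular
import Literature.AlgebraicGeometry.Resolution.RegularLocalRingsProofs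
import HarnessLib

/-!
# The VALUE of the cylinder rule and its PRESENTATION — (P3a-1) + (P3a-3) of ORDER (o28)
# (door `HypersurfaceCentreConstruction`, stmt-ResolutionOfSingularities-19897; KEY `stub_localWeightedDropEFT4S` beyond the
# P2 rung, regime P3a «the top stratum through the closed point is a regular germ of codimension two»)

Topic: `Summits/ResolutionOfSingularities/ResolutionOfSingularities/Theorems`. Helper for the door item
`HypersurfaceCentreConstruction` (stmt-ResolutionOfSingularities-19897, route `WeightedInvariant`), line `local-engine` of
res-L1-w43-plan-1 (L W4.3), DEALS gen 9 #25 (2026-08-27T09:49:02Z) / res-type-005 CUT 09:49:37Z: co-hand res-D-brk-1 on the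
(o28) lead res-type-005's probe `P3A-PROBE.md` + `P3A-signatures.lean` (sha16 `b0bbd99caca878e5`).  Sibling of res-type-005's
(P3a-2) COMPATIBILITY file `…ContactCylinderCompatibility` (whose contraction brick
`ContactCylinder.comap_map_weightedMonomialIdeal_eq_of_linearIndependent` is consumed here by name).

THE CYLINDER RULE reads the P2 centre filtration `jContact` (res-type-092, `…ContactCentreFiltration`) at the generic point of
the top stratum: at a regular local position `R` with stratum prime `𝔭` (`R_𝔭` regular local of Krull dimension two),
`J(R, f, m) := (jContact (R_𝔭) f m) ∩ R`.

## Contents (sorry-free, standard axioms; NO definitions)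

* `weightedMonomialIdeal_pair_eq_iSup` — the monomial identity `(x, g; 1, b)_m = ⨆_j (g^j) · (x, g)^(m − b j)` (truncated
  subtraction) in ANY commutative ring, `b ≥ 1`: the ORDER's shape `⨆_j (g^j) 𝔭^(m − b j)` of the cylinder value.
* **(P3a-1) `cylinder_comap_eq_weightedMonomialIdeal`** — `R` regular local, `𝔭 = (x, g)` prime with `x, g ∈ 𝔪` having
  independent differentials, `f/1 ≠ 0` NOT of monomial type in `R_𝔭`, `g/1` carrying `f/1` to the terminal level `b_max ≥ 1`
  of `R_𝔭`: `(jContact (R_𝔭) (f/1) m) ∩ R = (x, g; 1, b_max)_m` for every `m`.  Proof: `R_𝔭` is regular local (Matsumura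
  19.3, Literature `isRegularLocalRing_localization_atPrime`) with `𝔪_{R_𝔭} = (x/1, g/1)` (`Localization.AtPrime.map_eq_maximalIdeal`);
  `g/1 ∉ 𝔪_{R_𝔭}²` because `𝔭² R_𝔭 ∩ R = 𝔭²` (the weight-`(1,1)` piece is `𝔭`-primary — stub-10's primary lemma through 005's
  contraction brick) and `g ∉ 𝔪²` (independence); res-type-092's CASE B in coordinates `weightedMonomialIdeal_eq_jContact`
  in `R_𝔭`; `weightedMonomialIdeal_map`; contraction of the `𝔭`-primary piece `(x, g; 1, b_max)_m`, `m ≥ 1` (`m = 0`: both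
  sides `⊤`).  RESHAPE of the probe's signature (res-D-brk-1 09:59Z = res-type-061 INPUT 09:58:34Z): ONE extra binder
  `hb : 1 ≤ bMax (f/1)` — without it the statement fails in the junk corner `bMax = 0` (reached levels unbounded on a
  NON-excellent `R_𝔭`: `hreach` is then vacuous, the left side is `𝔭^m R_𝔭 ∩ R ∋ g^m`, the right side `(x, g; 1, 0)_m = (x^m)`);
  `hb` is res-type-092's hypothesis of `weightedMonomialIdeal_eq_jContact` and holds at every position essentially of finite
  type over a field (`one_le_bMax_and_reaches_of_essFiniteType`) — see `cylinder_comap_eq_weightedMonomialIdeal_of_essFiniteType`.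
* `cylinder_comap_eq_iSup` — the same in the ORDER's shape `⨆_j (g^j) 𝔭^(m − b_max j)`.
* `cylinder_comap_eq_weightedMonomialIdeal_of_essFiniteType` — the binder `hb` discharged for `R` essentially of finite type
  over a field `k₀` (the door's positions): `R_𝔭` is then essentially of finite type over `k₀`, hence excellent.
* **(P3a-3) `cylinder_presentation`** — the (pres) shape of `CanonicalGameClause` with weight `0` = OMISSION: on a model `A`
  with `𝔭 = (X, Y)`, `U = (X, Y)`, `W = (1, b)`; at a prime `𝔮 ⊇ 𝔭`, `(∀ i, U i ∈ 𝔮) ↔ 𝔭 ≤ 𝔮` and the cylinder value at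
  `A_𝔮` is `(weightedMonomialIdeal U W m) A_𝔮` (given the value `hval` at `R = A_𝔮`, `weightedMonomialIdeal_map`).

[OURS · L1 W4.3 · (o28) P3a probe]  Replaces the role of NO printed item; NOT a statement of the manuscript
[claim: Hironaka2017, status: under-review]. AI work, weaker than expert review.  Pure commutative algebra; no named facts.

## References

* H. Matsumura, *Commutative Ring Theory* (1987), Thm. 14.2, 16.2, 19.3. [Matsumura1987]
* J. Włodarczyk, *Functorial resolution except for toroidal locus. Toroidal compactification*, Lemma 2.1.12 (weighted
  monomial ideals). [Wlodarczyk2022]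
* res-type-005, `plan/tools/res-type-005/o28/P3A-PROBE.md` + `P3A-signatures.lean` (OURS, AI design input).
-/

noncomputable section

open IsLocalRing Literature.AlgebraicGeometry.Resolution
open Summit.ResolutionOfSingularities.ResolutionOfSingularities.Cruxes.HypersurfaceCentreConstruction.LocalEngine

set_option linter.dupNamespace false -- mandated namespace of this single-conjunct summit

namespace Summit.ResolutionOfSingularities.ResolutionOfSingularities.Theorems

namespace ContactCylinder

/-! ## The monomial identity `(x, g; 1, b)_m = ⨆_j (g^j) (x, g)^(m − b j)` -/

/-- **Monomial identity**: `(x, g; 1, b)_m = ⨆_j (g^j) · (x, g)^(m − b j)` (truncated subtraction) in any commutative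
ring, for `b ≥ 1`: a monomial `x^a g^c` of weight `a + b c ≥ m` lies in the piece `j = c` (`x^a ∈ (x, g)^(m − b c)`), and
`(g^j) (x, g)^(m − b j) ⊆ (x, g; 1, b)_{b j} · (x, g; 1, b)_{m − b j} ⊆ (x, g; 1, b)_m`. [cite: Wlodarczyk2022, Lemma 2.1.12] -/
theorem weightedMonomialIdeal_pair_eq_iSup {R : Type} [CommRing R] (x g : R) {b : ℕ} (hb : 1 ≤ b) (m : ℕ) :
    weightedMonomialIdeal ![x, g] ![1, b] m = ⨆ j : ℕ, Ideal.span {g ^ j} * Ideal.span {x, g} ^ (m - b * j) := by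
  apply le_antisymm
  · rw [weightedMonomialIdeal, Ideal.span_le]
    rintro _ ⟨α, hα, rfl⟩
    simp only [Fin.sum_univ_two, Matrix.cons_val_zero, Matrix.cons_val_one, one_mul] at hα
    rw [Fin.prod_univ_two]
    simp only [Matrix.cons_val_zero, Matrix.cons_val_one, SetLike.mem_coe]
    rw [mul_comm]
    refine le_iSup (fun j => Ideal.span {g ^ j} * Ideal.span {x, g} ^ (m - b * j)) (α 1) ?_
    exact Ideal.mul_mem_mul (Ideal.mem_span_singleton_self _)
      (Ideal.pow_le_pow_right (by omega) (Ideal.pow_mem_pow (Ideal.subset_span (by simp)) (α 0)))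
  · refine iSup_le fun j => ?_
    have h1 : Ideal.span {g ^ j} ≤ weightedMonomialIdeal ![x, g] ![1, b] (b * j) := by
      rw [Ideal.span_singleton_le_iff_mem]
      simpa [Nat.mul_comm] using
        pow_mem_weightedMonomialIdeal ![x, g] ![1, b] (LocalGameEFTSteepening.snd_mem x g b) j
    have h2 : Ideal.span {x, g} ^ (m - b * j) ≤ weightedMonomialIdeal ![x, g] ![1, b] (m - b * j) :=
      LocalGameEFTSteepening.span_pair_pow_le x g hb _
    refine le_trans (Ideal.mul_mono h1 h2) (le_trans (weightedMonomialIdeal_mul_le ![x, g] ![1, b] _ _) ?_)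
    exact weightedMonomialIdeal_antitone _ _ (by omega)

/-! ## (P3a-1) VALUE of the cylinder rule -/

section Value

variable (R : Type) [CommRing R] [IsRegularLocalRing R] (x g : R)
  (hxg : ∀ i, (![x, g] : Fin 2 → R) i ∈ maximalIdeal R)
  (hli : LinearIndependent (ResidueField R) (fun i => (maximalIdeal R).toCotangent ⟨(![x, g] : Fin 2 → R) i, hxg i⟩))

include hli in
/-- **A pair with independent differentials stays a regular system of parameters at the prime it generates**: for
`x, g ∈ 𝔪_R` with independent differentials and `𝔭 = (x, g)` prime, `𝔪_{R_𝔭} = (x/1, g/1)` and `g/1 ∉ 𝔪_{R_𝔭}²`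
(`𝔭² R_𝔭 ∩ R = 𝔭² ⊆ 𝔪²` by primary contraction of the weight-`(1,1)` piece, and `g ∉ 𝔪²`). [cite: Matsumura1987, Thm. 16.2] -/
theorem span_pair_eq_maximalIdeal_atPrime_and_not_mem_sq [(Ideal.span {x, g}).IsPrime] :
    Ideal.span {algebraMap R (Localization.AtPrime (Ideal.span {x, g})) x,
        algebraMap R (Localization.AtPrime (Ideal.span {x, g})) g} =
      maximalIdeal (Localization.AtPrime (Ideal.span {x, g})) ∧
    algebraMap R (Localization.AtPrime (Ideal.span {x, g})) g ∉
      maximalIdeal (Localization.AtPrime (Ideal.span {x, g})) ^ 2 := by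
  have hx𝔭 : ∀ i, (![x, g] : Fin 2 → R) i ∈ Ideal.span {x, g} := fun i =>
    Ideal.subset_span (by fin_cases i <;> simp)
  have hmax : Ideal.span {algebraMap R (Localization.AtPrime (Ideal.span {x, g})) x,
      algebraMap R (Localization.AtPrime (Ideal.span {x, g})) g} =
      maximalIdeal (Localization.AtPrime (Ideal.span {x, g})) := by
    rw [← Localization.AtPrime.map_eq_maximalIdeal, Ideal.map_span, Set.image_insert_eq, Set.image_singleton]
  refine ⟨hmax, fun h => ?_⟩
  -- `𝔪_{R_𝔭}² = ((x, g; 1, 1)_2) R_𝔭`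
  have hvec : (fun i => algebraMap R (Localization.AtPrime (Ideal.span {x, g})) ((![x, g] : Fin 2 → R) i)) =
      ![algebraMap R (Localization.AtPrime (Ideal.span {x, g})) x,
        algebraMap R (Localization.AtPrime (Ideal.span {x, g})) g] := by
    funext i; fin_cases i <;> rfl
  have hQ : maximalIdeal (Localization.AtPrime (Ideal.span {x, g})) ^ 2 =
      (weightedMonomialIdeal ![x, g] ![1, 1] 2).map (algebraMap R (Localization.AtPrime (Ideal.span {x, g}))) := by
    rw [← hmax, ← LocalGameEFTSteepening.weightedMonomialIdeal_one_eq_pow, weightedMonomialIdeal_map, hvec]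
  rw [hQ, ← Ideal.mem_comap,
    comap_map_weightedMonomialIdeal_eq_of_linearIndependent (Ideal.span {x, g}) ![x, g] hxg hli hx𝔭 ![1, 1]
      (Fin.forall_fin_two.2 ⟨Nat.one_pos, Nat.one_pos⟩) one_le_two,
    LocalGameEFTSteepening.weightedMonomialIdeal_one_eq_pow] at h
  -- `g ∈ 𝔭² ⊆ 𝔪²` contradicts the independence of the differentials
  have h𝔭𝔪 : Ideal.span {x, g} ≤ maximalIdeal R := by
    rw [Ideal.span_le, Set.insert_subset_iff, Set.singleton_subset_iff]
    exact ⟨hxg 0, hxg 1⟩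
  exact hli.ne_zero 1 ((Ideal.toCotangent_eq_zero _ _).mpr (Ideal.pow_right_mono h𝔭𝔪 2 h))

include hli in
/-- **(P3a-1) VALUE of the cylinder rule.**  `R` regular local, `𝔭 = (x, g)` a prime generated by two elements of `𝔪_R`
with independent differentials (so `R_𝔭` is regular local with regular system of parameters `(x/1, g/1)`), `f ∈ R` with
`f/1 ≠ 0` NOT of monomial type in `R_𝔭`, `g/1` a contact parameter of `f/1` reaching the terminal level `b_max` of `R_𝔭`,
and `b_max ≥ 1` (binder `hb`, = res-type-092's hypothesis of `weightedMonomialIdeal_eq_jContact`; it fails only when the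
reached levels are unbounded, i.e. on a non-excellent `R_𝔭`, and is discharged at every position essentially of finite type
over a field by `cylinder_comap_eq_weightedMonomialIdeal_of_essFiniteType`): for every `m`,
`(jContact (R_𝔭) (f/1) m) ∩ R = (x, g; 1, b_max)_m`. [OURS · L1 W4.3 · (o28) P3a-1] -/
theorem cylinder_comap_eq_weightedMonomialIdeal [(Ideal.span {x, g}).IsPrime] (f : R)
    (hf0 : algebraMap R (Localization.AtPrime (Ideal.span {x, g})) f ≠ 0)
    (hnm : ¬ IsMonomialType (algebraMap R (Localization.AtPrime (Ideal.span {x, g})) f))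
    (hreach : algebraMap R (Localization.AtPrime (Ideal.span {x, g})) f ∈
      contactFiltration (algebraMap R (Localization.AtPrime (Ideal.span {x, g})) g)
        (bMax (algebraMap R (Localization.AtPrime (Ideal.span {x, g})) f))
        (bMax (algebraMap R (Localization.AtPrime (Ideal.span {x, g})) f) *
          (adicOrder (algebraMap R (Localization.AtPrime (Ideal.span {x, g})) f)).toNat))
    (hb : 1 ≤ bMax (algebraMap R (Localization.AtPrime (Ideal.span {x, g})) f))
    (m : ℕ) :
    (jContact (Localization.AtPrime (Ideal.span {x, g}))
        (algebraMap R (Localization.AtPrime (Ideal.span {x, g})) f) m).comap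
      (algebraMap R (Localization.AtPrime (Ideal.span {x, g}))) =
      weightedMonomialIdeal ![x, g] ![1, bMax (algebraMap R (Localization.AtPrime (Ideal.span {x, g})) f)] m := by
  haveI : IsRegularLocalRing (Localization.AtPrime (Ideal.span {x, g})) :=
    isRegularLocalRing_localization_atPrime R (Ideal.span {x, g})
  obtain ⟨hmax, hg2⟩ := span_pair_eq_maximalIdeal_atPrime_and_not_mem_sq R x g hxg hli
  have hx𝔭 : ∀ i, (![x, g] : Fin 2 → R) i ∈ Ideal.span {x, g} := fun i =>
    Ideal.subset_span (by fin_cases i <;> simp)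
  have hvec : (fun i => algebraMap R (Localization.AtPrime (Ideal.span {x, g})) ((![x, g] : Fin 2 → R) i)) =
      ![algebraMap R (Localization.AtPrime (Ideal.span {x, g})) x,
        algebraMap R (Localization.AtPrime (Ideal.span {x, g})) g] := by
    funext i; fin_cases i <;> rfl
  -- CASE B of the P2 table in `R_𝔭`, in the coordinates `(x/1, g/1)`, pushed through `R → R_𝔭`
  have hJ : jContact (Localization.AtPrime (Ideal.span {x, g}))
        (algebraMap R (Localization.AtPrime (Ideal.span {x, g})) f) m =
      (weightedMonomialIdeal ![x, g] ![1, bMax (algebraMap R (Localization.AtPrime (Ideal.span {x, g})) f)] m).map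
        (algebraMap R (Localization.AtPrime (Ideal.span {x, g}))) := by
    rw [← weightedMonomialIdeal_eq_jContact (Localization.AtPrime (Ideal.span {x, g})) hf0 hnm hmax hg2 hb hreach m,
      weightedMonomialIdeal_map, hvec]
  rw [hJ]
  rcases Nat.eq_zero_or_pos m with rfl | hm
  · rw [weightedMonomialIdeal_zero, Ideal.map_top, Ideal.comap_top]
  · exact comap_map_weightedMonomialIdeal_eq_of_linearIndependent (Ideal.span {x, g}) ![x, g] hxg hli hx𝔭
      ![1, bMax (algebraMap R (Localization.AtPrime (Ideal.span {x, g})) f)] (Fin.forall_fin_two.2 ⟨Nat.one_pos, hb⟩) hm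

include hli in
/-- **(P3a-1) in the ORDER's shape**: `(jContact (R_𝔭) (f/1) m) ∩ R = ⨆_j (g^j) 𝔭^(m − b_max j)`, `𝔭 = (x, g)`
(`cylinder_comap_eq_weightedMonomialIdeal` + `weightedMonomialIdeal_pair_eq_iSup`). [OURS · L1 W4.3 · (o28) P3a-1] -/
theorem cylinder_comap_eq_iSup [(Ideal.span {x, g}).IsPrime] (f : R)
    (hf0 : algebraMap R (Localization.AtPrime (Ideal.span {x, g})) f ≠ 0)
    (hnm : ¬ IsMonomialType (algebraMap R (Localization.AtPrime (Ideal.span {x, g})) f))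
    (hreach : algebraMap R (Localization.AtPrime (Ideal.span {x, g})) f ∈
      contactFiltration (algebraMap R (Localization.AtPrime (Ideal.span {x, g})) g)
        (bMax (algebraMap R (Localization.AtPrime (Ideal.span {x, g})) f))
        (bMax (algebraMap R (Localization.AtPrime (Ideal.span {x, g})) f) *
          (adicOrder (algebraMap R (Localization.AtPrime (Ideal.span {x, g})) f)).toNat))
    (hb : 1 ≤ bMax (algebraMap R (Localization.AtPrime (Ideal.span {x, g})) f))
    (m : ℕ) :
    (jContact (Localization.AtPrime (Ideal.span {x, g}))
        (algebraMap R (Localization.AtPrime (Ideal.span {x, g})) f) m).comap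
      (algebraMap R (Localization.AtPrime (Ideal.span {x, g}))) =
      ⨆ j : ℕ, Ideal.span {g ^ j} *
        Ideal.span {x, g} ^ (m - bMax (algebraMap R (Localization.AtPrime (Ideal.span {x, g})) f) * j) := by
  rw [cylinder_comap_eq_weightedMonomialIdeal R x g hxg hli f hf0 hnm hreach hb m,
    weightedMonomialIdeal_pair_eq_iSup x g hb m]

/-- Off the monomial type a non-zero `f` lies in `𝔪²` (as soon as a regular parameter exists): its order `ν` is `≥ 1`,
and `ν = 1` would make `f` itself a regular parameter, `f = 1 · f^1` of monomial type. [folklore] -/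
theorem mem_sq_of_not_isMonomialType {S : Type} [CommRing S] [IsRegularLocalRing S] {f : S} (hf0 : f ≠ 0)
    (hnm : ¬ IsMonomialType f) (hpar : ∃ g ∈ maximalIdeal S, g ∉ maximalIdeal S ^ 2) :
    f ∈ maximalIdeal S ^ 2 := by
  obtain ⟨ν, -, -, hν1, hfmem, hford⟩ := exists_adicOrder_eq_of_not_isMonomialType hf0 hnm hpar
  by_cases hν : ν = 1
  · subst hν
    rw [pow_one] at hfmem
    exact absurd ⟨1, f, 1, isUnit_one, hfmem, hford, by rw [one_mul, pow_one]⟩ hnm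
  · exact Ideal.pow_le_pow_right (show 2 ≤ ν by omega) hfmem

include hli in
/-- **(P3a-1) at the door's positions** (`R` essentially of finite type over a field `k₀`): the binder `hb` is discharged —
`R_𝔭` is essentially of finite type over `k₀`, hence excellent, so `b_max (f/1) ≥ 1` and `b_max` is attained
(res-type-092's `one_le_bMax_and_reaches_of_essFiniteType`; `f/1 ∈ 𝔪_{R_𝔭}²` by `mem_sq_of_not_isMonomialType`).
[OURS · L1 W4.3 · (o28) P3a-1] -/
theorem cylinder_comap_eq_weightedMonomialIdeal_of_essFiniteType (k₀ : Type) [Field k₀] [Algebra k₀ R]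
    [Algebra.EssFiniteType k₀ R] [(Ideal.span {x, g}).IsPrime] (f : R)
    (hf0 : algebraMap R (Localization.AtPrime (Ideal.span {x, g})) f ≠ 0)
    (hnm : ¬ IsMonomialType (algebraMap R (Localization.AtPrime (Ideal.span {x, g})) f))
    (hreach : algebraMap R (Localization.AtPrime (Ideal.span {x, g})) f ∈
      contactFiltration (algebraMap R (Localization.AtPrime (Ideal.span {x, g})) g)
        (bMax (algebraMap R (Localization.AtPrime (Ideal.span {x, g})) f))
        (bMax (algebraMap R (Localization.AtPrime (Ideal.span {x, g})) f) *
          (adicOrder (algebraMap R (Localization.AtPrime (Ideal.span {x, g})) f)).toNat))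
    (m : ℕ) :
    1 ≤ bMax (algebraMap R (Localization.AtPrime (Ideal.span {x, g})) f) ∧
    (jContact (Localization.AtPrime (Ideal.span {x, g}))
        (algebraMap R (Localization.AtPrime (Ideal.span {x, g})) f) m).comap
      (algebraMap R (Localization.AtPrime (Ideal.span {x, g}))) =
      weightedMonomialIdeal ![x, g] ![1, bMax (algebraMap R (Localization.AtPrime (Ideal.span {x, g})) f)] m := by
  haveI : IsRegularLocalRing (Localization.AtPrime (Ideal.span {x, g})) :=
    isRegularLocalRing_localization_atPrime R (Ideal.span {x, g})
  obtain ⟨hmax, hg2⟩ := span_pair_eq_maximalIdeal_atPrime_and_not_mem_sq R x g hxg hli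
  have hg : algebraMap R (Localization.AtPrime (Ideal.span {x, g})) g ∈
      maximalIdeal (Localization.AtPrime (Ideal.span {x, g})) := hmax ▸ Ideal.subset_span (by simp)
  have hf2 := mem_sq_of_not_isMonomialType hf0 hnm ⟨_, hg, hg2⟩
  have hb := (one_le_bMax_and_reaches_of_essFiniteType k₀ (Localization.AtPrime (Ideal.span {x, g})) hf0 hf2 hnm).1
  exact ⟨hb, cylinder_comap_eq_weightedMonomialIdeal R x g hxg hli f hf0 hnm hreach hb m⟩

end Value

/-! ## (P3a-3) PRESENTATION (the (pres) shape of `CanonicalGameClause`, weight `0` = omission) -/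

/-- **(P3a-3) PRESENTATION on a model.**  `A` a ring, `𝔭 = (X, Y) ⊆ A` with `A_𝔮` regular and `X, Y` part of a regular
system of parameters at every prime `𝔮 ⊇ 𝔭` under consideration; `F ∈ A` with `F/1` not of monomial type in `A_𝔭` and
`Y/1` a terminal contact parameter at level `b = b_max` there.  Then with `U = (X, Y)`, `W = (1, b)` (both POSITIVE; the
parameters transversal to the stratum are NOT listed): at every such `𝔮`, `(∀ i, U i ∈ 𝔮) ↔ 𝔭 ≤ 𝔮` and the cylinder value
`(jContact ((A_𝔮)_{𝔭A_𝔮}) F m) ∩ A_𝔮 = (weightedMonomialIdeal U W m) A_𝔮`.  The hypothesis `hval` is the (P3a-1) value at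
`R = A_𝔮` (`cylinder_comap_eq_weightedMonomialIdeal`); `hXY`, `hli`, `h𝔮` and the regularity of `A_𝔮` are the data that
produce it there and are idle in this transport step (`weightedMonomialIdeal_map`). [OURS · L1 W4.3 · (o28) P3a-3] -/
theorem cylinder_presentation (A : Type) [CommRing A] (X Y F : A) [(Ideal.span {X, Y}).IsPrime]
    (𝔮 : Ideal A) [𝔮.IsPrime] (h𝔮 : Ideal.span {X, Y} ≤ 𝔮) [IsRegularLocalRing (Localization.AtPrime 𝔮)]
    (hXY : ∀ i, (![algebraMap A (Localization.AtPrime 𝔮) X, algebraMap A (Localization.AtPrime 𝔮) Y] : Fin 2 → _) i ∈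
      maximalIdeal (Localization.AtPrime 𝔮))
    (_hli : LinearIndependent (ResidueField (Localization.AtPrime 𝔮)) (fun i =>
      (maximalIdeal (Localization.AtPrime 𝔮)).toCotangent
        ⟨(![algebraMap A (Localization.AtPrime 𝔮) X, algebraMap A (Localization.AtPrime 𝔮) Y] : Fin 2 → _) i, hXY i⟩))
    [((Ideal.span {X, Y}).map (algebraMap A (Localization.AtPrime 𝔮))).IsPrime]
    (b m : ℕ)
    (hval : (jContact (Localization.AtPrime ((Ideal.span {X, Y}).map (algebraMap A (Localization.AtPrime 𝔮))))
        (algebraMap A _ F) m).comap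
        (algebraMap (Localization.AtPrime 𝔮)
          (Localization.AtPrime ((Ideal.span {X, Y}).map (algebraMap A (Localization.AtPrime 𝔮))))) =
        weightedMonomialIdeal ![algebraMap A (Localization.AtPrime 𝔮) X, algebraMap A (Localization.AtPrime 𝔮) Y] ![1, b] m) :
    ((∀ i, (![X, Y] : Fin 2 → A) i ∈ 𝔮) ↔ Ideal.span {X, Y} ≤ 𝔮) ∧
    (jContact (Localization.AtPrime ((Ideal.span {X, Y}).map (algebraMap A (Localization.AtPrime 𝔮))))
        (algebraMap A _ F) m).comap
        (algebraMap (Localization.AtPrime 𝔮)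
          (Localization.AtPrime ((Ideal.span {X, Y}).map (algebraMap A (Localization.AtPrime 𝔮))))) =
      (weightedMonomialIdeal ![X, Y] ![1, b] m).map (algebraMap A (Localization.AtPrime 𝔮)) := by
  have hvec : (fun i => algebraMap A (Localization.AtPrime 𝔮) ((![X, Y] : Fin 2 → A) i)) =
      ![algebraMap A (Localization.AtPrime 𝔮) X, algebraMap A (Localization.AtPrime 𝔮) Y] := by
    funext i; fin_cases i <;> rfl
  refine ⟨⟨fun _ => h𝔮, fun h i => h (Ideal.subset_span (by fin_cases i <;> simp))⟩, ?_⟩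
  rw [hval, weightedMonomialIdeal_map, hvec]

end ContactCylinder

end Summit.ResolutionOfSingularities.ResolutionOfSingularities.Theorems

end
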